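import Summits.BirchSwinnertonDyer.BirchSwinnertonDyer.Theorems.Rank2ObservatoryPadicAtlasKitOdd
import Summits.BirchSwinnertonDyer.BirchSwinnertonDyer.Theorems.Rank2ObservatoryPadicAtlasKitR3
import HarnessLib

/-!
# BirchSwinnertonDyer — rank ≥ 2 observatory: the atlas kit at a prime dividing `r!` (rank `3` at `p = 3`)

HONEST FRAMING: per-curve certified theorems and census instruments; no claim on BSD in rank ≥ 2.

Module of the series `Rank2ObservatoryPadic*.lean` (generic squeeze `Rank2ObservatoryPadicRow.lean`,
symbol tables `Rank2ObservatoryPadicSymbolTableL.lean`, atlas kits `Rank2ObservatoryPadicAtlasKit.lean` /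
`…KitR3` / `…KitOdd`, machine-written parts `Rank2ObservatoryPadicAtlas{R2A,R3A,P3R2A}*.lean`). The ONE
place where the series asks `p ∤ r!` is the kernel squeeze `coeff_ne_zero_of_symbolTableL` (the Boolean
`SymbolCertL.validL` tests `¬ p ∣ r!`): the truncation error of the level-`p^{n+1}` Riemann sum `RS(r, n)` of
`coeff_ne_zero_of_riemannSum_certificate` is `(C / ‖r!‖_p) · p^{-n}`, and with `‖r!‖_p = 1` the certificate
reads `p^n ∤ A·ΣHi − ΣLo`. This excludes exactly one class of the census instruments: rank `3` at `p = 3`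
(`3 ∣ 3!`). This file removes the hypothesis, at the price the error term dictates: with `p^v ‖ r!`
(witnessed by `p^v · m = r!`, `p ∤ m`, so `‖r!‖_p = p^{-v}`) the error is `p^{-(n - v)}` and the certificate
reads `p^{n-v} ∤ A·ΣHi − ΣLo` (`v ≤ n`); for `p ∤ r!` (`v = 0`) it is the old one verbatim
(`SymbolCertL.validLv_of_validL`).

* `coeff_ne_zero_of_symbolTableLv` — `[T^r] L_p ≠ 0` from a level-`p^{n+1}` plus-symbol table, the digits of
  the unit root and `p^{n-v} ∤ A·H − L`, `p^v ‖ r!` (same proof as `coeff_ne_zero_of_symbolTableL`, the norm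
  of `r!` computed instead of assumed `1`);
* `SymbolCertL.validLv` — the Boolean validity test with the conjunct `¬ p ∣ r!` replaced by
  `∃ v ≤ n, p^v · (r!/p^v) = r! ∧ p ∤ r!/p^v ∧ p^{n-v} ∤ A·H − L` (self-certifying: the kernel finds `v`
  by bounded search, no valuation function is evaluated); `coeff_ne_zero_of_symbolCertLv`,
  `padicRow_of_symbolCertLv_odd` (the row theorem at an odd prime: `rank = r`, `ord_{T=0} L_p = r`,
  `Ш[p^∞]` finite, Schneider non-degeneracy for every canonical height datum, `corank Sel_{p^∞} = r`, GIVEN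
  `hPRS : Schneider1985_order_charGenerator_odd`, `hσ : mazur_tate_sigma_exists_odd`, `hkato`, the newform and
  the symbol DATA, exactly as `padicRow_of_symbolCertL_odd`);
* the cell / curve tests of the RANK-3 atlas at an odd prime: `AtlasCell.checkOdd3` (= `AtlasCell.check3`
  with `5 ≤ p` replaced by `p ≠ 2` and `validL` by `validLv`, on the SAME datum `AtlasCell` and the same
  `certL3`), `AtlasCurve3.checkOdd`, `AtlasCurve3.minCheck₃`, the row theorem `AtlasCurve3.padicRowOdd`
  (`hlow : 3 ≤ rank`, conclusion `rank = 3`, …, `corank Sel_{p^∞} = 3`) and the table accessors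
  `AtlasCurve3.check_of_allOdd` / `…Odd₂` / `…Odd₃`;
* `AtlasCell.checkOdd3_of_check3`: every landed rank-3 cell (`p ≥ 5`) passes the new test.

Consumers: the machine-written parts `Rank2ObservatoryPadicAtlasP3R3A*.lean` (two-engine plus-symbol tables
at `3^n`, `3^{n+1}` for the rank-3 census cells `(E, 3)` with an engine-B `L`-side row; level `n = v + 2`,
`v = v_3([T³]_B)`; generator `code/b2b-bsdr2-padic-2/gen7/gen_atlas_p3r3.py` of the cell folder). What is
NOT claimed: nothing at `p = 2`, for supersingular or bad `p`, about `ord_{s=1} L(E, s)` or `#Ш`. No new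
mathematical objects (three Boolean tests, one abbreviation), no new axioms, no `sorry`, no `native_decide`.

References: B. Mazur, J. Tate, J. Teitelbaum, Invent. Math. 84 (1986), §I.10–I.13; W. Stein, C. Wuthrich,
Math. Comp. 82 (2013), §3 (the `ord_p(j!)` precision loss); J. Balakrishnan, J. S. Müller, W. Stein, Math. Comp.
85 (2016), Thm. 1.7 and p. 3; B. Mazur, W. Stein, J. Tate, Doc. Math. Extra Vol. (2006), Thm. 1.3; K. Kato,
Astérisque 295 (2004), Thm. 17.4; J. Cremona, Algorithms (1997), §2.13, §3.5; J. Silverman, AEC (2009), VII.1.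
-/

-- single-conjunct summit: `Summit.BirchSwinnertonDyer.BirchSwinnertonDyer.…` repeats the name by design
set_option linter.dupNamespace false

noncomputable section

open scoped Classical

namespace Summit.BirchSwinnertonDyer.BirchSwinnertonDyer.Rank2Observatory

open scoped MatrixGroups ModularForm
open CongruenceSubgroup Literature.NumberTheory.EllipticCurves
  Literature.NumberTheory.EllipticCurves.ModularForms WeierstrassCurve
open Literature.NumberTheory.Sieve.GoldbachLinnik (primeB prime_of_primeB)

section HigherLevel

variable (p : ℕ) [Fact p.Prime]

/-- **`[T^r] L_p ≠ 0` from a level-`p^{n+1}` symbol table and the digits of `α`, for ANY `r`** (odd good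
ordinary `p`; `p^v ‖ r!` witnessed by `p^v · m = r!`, `p ∤ m`, `v ≤ n`): with `A ≡ α (mod p^n)` and
`p^{n-v} ∤ A·ΣHi − ΣLo` one gets `‖RS(r, n)‖ = ‖A ΣHi − ΣLo‖ > p^{-(n-v)} = p^{-n}/‖r!‖_p =` the truncation
error, so `coeff_ne_zero_of_riemannSum_certificate` (`C = 1` by `hint`) applies. For `v = 0` this is
`coeff_ne_zero_of_symbolTableL`. [cite: MazurTateTeitelbaum1986Invent, §I.10–I.13] [cite: SteinWuthrich2013, §3] -/
theorem coeff_ne_zero_of_symbolTableLv (hp2 : p ≠ 2) (W : WeierstrassCurve ℚ) [W.IsElliptic]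
    [W.IsGloballyMinimal] {N : ℕ} [NeZero N] {f : CuspForm (Gamma0 N) 2}
    (hord : IsOrdinaryAt W p) (hf : IsNewformOf W f) {r : ℕ} (v m : ℕ) (hfac : p ^ v * m = r.factorial)
    (hm : ¬ p ∣ m) (n : ℕ) (hvn : v ≤ n)
    (tabHi tabLo : List ℤ) (D : ℚ) (hD : ‖(D : ℚ_[p])‖ = 1) (H L A : ℤ)
    (hA : (p : ℤ) ^ n ∣ A ^ 2 - W.frobeniusTrace p * A + p) (hAu : ¬ (p : ℤ) ∣ A)
    (hHL : ¬ (p : ℤ) ^ (n - v) ∣ A * H - L)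
    (hcard : (teichSet p (n + 1)).card = torsionOrder p)
    (hunit : ∀ y ∈ teichSet p (n + 1), ∀ s : ZMod (p ^ n),
      ¬ p ∣ (y * ((1 + p : ℕ) : ZMod (p ^ (n + 1))) ^ s.val).val)
    (hHi : isumL p n tabHi r = H) (hLo : isumL p n tabLo r = L)
    (hint : ∀ x : ℚ, ‖(ratPlusSymbol f x : ℚ_[p])‖ ≤ 1)
    (htab : ∀ u : ℕ, u < p ^ (n + 1) → ¬ p ∣ u →
      ratPlusSymbol f ((u : ℚ) / (p : ℚ) ^ (n + 1)) = (tabHi.getD u 0 : ℚ) / D ∧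
      ratPlusSymbol f ((u : ℚ) / (p : ℚ) ^ n) = (tabLo.getD u 0 : ℚ) / D) :
    PowerSeries.coeff r (padicLFunction f (unitRoot W p : ℚ_[p])) ≠ 0 := by
  have hα : ‖(unitRoot W p : ℚ_[p])‖ = 1 := norm_unitRoot_holds W p hord
  have hαA := norm_unitRoot_sub_int_le p W hord A n hA hAu
  set α : ℚ_[p] := (unitRoot W p : ℚ_[p]) with hαdef
  have hα0 : α ≠ 0 := fun h => by rw [h, norm_zero] at hα; exact zero_ne_one hα
  have hD0 : (D : ℚ_[p]) ≠ 0 := fun h => by rw [h, norm_zero] at hD; exact zero_ne_one hD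
  have hp1 : (1 : ℝ) ≤ p := by exact_mod_cast (Fact.out : p.Prime).one_lt.le
  have hp0 : (0 : ℝ) < p := by exact_mod_cast (Fact.out : p.Prime).pos
  refine coeff_ne_zero_of_riemannSum_certificate W p hord hf (C := 1)
    (norm_msdMeasure_le_one p f _ hα hint) (n := n) ?_
  rw [padicLRiemannSum_eq_isumL p f _ r n hp2 tabHi tabLo D hcard hunit htab, hHi, hLo]
  -- `‖r!‖_p = p^{-v}` from the witnessed factorisation `p^v · m = r!`, `p ∤ m`
  have hmn : ‖((m : ℕ) : ℚ_[p])‖ = 1 := by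
    rw [Padic.norm_natCast_eq_one_iff]
    exact (Nat.Prime.coprime_iff_not_dvd Fact.out).mpr hm
  have hfacn : ‖((r.factorial : ℕ) : ℚ_[p])‖ = (p : ℝ) ^ (-(v : ℤ)) := by
    rw [← hfac, Nat.cast_mul, Nat.cast_pow, norm_mul, norm_pow, Padic.norm_p, hmn, mul_one, inv_pow,
      ← zpow_natCast, ← zpow_neg]
  have herr : 1 / (p : ℝ) ^ (-(v : ℤ)) * (p : ℝ) ^ (-(n : ℤ)) = (p : ℝ) ^ (-((n - v : ℕ) : ℤ)) := by
    rw [one_div, ← zpow_neg, neg_neg, ← zpow_add₀ hp0.ne', Nat.cast_sub hvn]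
    congr 1
    ring
  rw [hfacn, herr]
  have hαinv : α⁻¹ * α = 1 := inv_mul_cancel₀ hα0
  have hfactor : α⁻¹ ^ (n + 1) * ((((H : ℤ) : ℚ) / D : ℚ) : ℚ_[p]) -
      α⁻¹ ^ (n + 2) * ((((L : ℤ) : ℚ) / D : ℚ) : ℚ_[p]) =
        α⁻¹ ^ (n + 2) * ((D : ℚ_[p]))⁻¹ * (α * H - L) := by
    push_cast [Rat.cast_div]
    rw [div_eq_mul_inv, div_eq_mul_inv]
    linear_combination (-(α⁻¹ ^ (n + 1) * ((H : ℤ) : ℚ_[p]) * ((D : ℚ_[p]))⁻¹)) * hαinv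
  rw [hfactor, norm_mul, norm_mul, norm_pow, norm_inv, hα, inv_one, one_pow, one_mul, norm_inv, hD,
    inv_one, one_mul]
  have h1 : ¬ ‖(((A * H - L : ℤ)) : ℚ_[p])‖ ≤ (p : ℝ) ^ (-((n - v : ℕ) : ℤ)) := by
    rw [Padic.norm_int_le_pow_iff_dvd]; exact hHL
  have hmono : (p : ℝ) ^ (-(n : ℤ)) ≤ (p : ℝ) ^ (-((n - v : ℕ) : ℤ)) :=
    zpow_le_zpow_right₀ hp1 (by omega)
  have h2 : ‖(α - A) * (H : ℚ_[p])‖ ≤ (p : ℝ) ^ (-((n - v : ℕ) : ℤ)) := by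
    rw [norm_mul]
    calc ‖α - A‖ * ‖((H : ℤ) : ℚ_[p])‖ ≤ (p : ℝ) ^ (-(n : ℤ)) * 1 :=
          mul_le_mul hαA (Padic.norm_int_le_one H) (norm_nonneg _) (zpow_nonneg (Nat.cast_nonneg _) _)
      _ ≤ (p : ℝ) ^ (-((n - v : ℕ) : ℤ)) := by rw [mul_one]; exact hmono
  have hsplit : α * H - L = (((A * H - L : ℤ)) : ℚ_[p]) + (α - A) * H := by push_cast; ring
  rw [hsplit, Padic.add_eq_max_of_ne (ne_of_gt (lt_of_le_of_lt h2 (not_le.mp h1)))]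
  exact lt_max_of_lt_left (not_le.mp h1)

/-- The Boolean VALIDITY test of a `SymbolCertL` at the prime `p` with Frobenius trace `ap`, for ANY `r`
(kernel-evaluated): `validL` with the conjunct `p ∤ r!` replaced by the bounded search
`∃ v ≤ n, p^v · (r!/p^v) = r! ∧ p ∤ r!/p^v ∧ p^{n-v} ∤ A·H − L` (so `v = ord_p(r!)` is FOUND and CHECKED,
never computed by a valuation function): `p ≠ 2`, `p^n ∣ A² − ap·A + p`, `p ∤ A`, the search,
`#teichSet p (n+1) = τ`, unit classes, `ΣHi = H`, `ΣLo = L`. [cite: MazurTateTeitelbaum1986Invent, §I.10–I.13]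
[cite: SteinWuthrich2013, §3] -/
def SymbolCertL.validLv (ap : ℤ) (c : SymbolCertL) : Bool :=
  decide (p ≠ 2 ∧ (p : ℤ) ^ c.n ∣ c.A ^ 2 - ap * c.A + p ∧ ¬ (p : ℤ) ∣ c.A ∧
    (∃ v ∈ Finset.range (c.n + 1), p ^ v * (c.r.factorial / p ^ v) = c.r.factorial ∧
      ¬ p ∣ c.r.factorial / p ^ v ∧ ¬ (p : ℤ) ^ (c.n - v) ∣ c.A * c.H - c.L) ∧
    (teichSet p (c.n + 1)).card = torsionOrder p ∧
    (∀ y ∈ teichSet p (c.n + 1), ∀ s : ZMod (p ^ c.n),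
      ¬ p ∣ (y * ((1 + p : ℕ) : ZMod (p ^ (c.n + 1))) ^ s.val).val) ∧
    isumL p c.n c.tabHi c.r = c.H ∧ isumL p c.n c.tabLo c.r = c.L)

/-- The `p ∤ r!` test `validL` implies the general test `validLv` (witness `v = 0`). [folklore] -/
theorem SymbolCertL.validLv_of_validL {ap : ℤ} {c : SymbolCertL} (h : c.validL p ap = true) :
    c.validLv p ap = true := by
  obtain ⟨hp2, hr, hA, hAu, hHL, hcard, hunit, hHi, hLo⟩ := of_decide_eq_true h
  refine decide_eq_true ⟨hp2, hA, hAu, ⟨0, Finset.mem_range.mpr (Nat.succ_pos _), ?_, ?_, ?_⟩, hcard,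
    hunit, hHi, hLo⟩
  · simp
  · simpa using hr
  · simpa using hHL

/-- **`[T^r] L_p ≠ 0` from a `SymbolCertL` passing `validLv`** (`coeff_ne_zero_of_symbolTableLv` with the
decidable side conditions bundled; `hap` identifies the Frobenius trace used in the congruence for `A`).
[cite: MazurTateTeitelbaum1986Invent, §I.10–I.13] [cite: SteinWuthrich2013, §3] -/
theorem coeff_ne_zero_of_symbolCertLv (W : WeierstrassCurve ℚ) [W.IsElliptic] [W.IsGloballyMinimal]
    {N : ℕ} [NeZero N] {f : CuspForm (Gamma0 N) 2} (hord : IsOrdinaryAt W p) (hf : IsNewformOf W f)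
    {ap : ℤ} (hap : W.frobeniusTrace p = ap) (c : SymbolCertL) (hc : c.validLv p ap = true) (D : ℚ)
    (hD : ‖(D : ℚ_[p])‖ = 1) (hint : ∀ x : ℚ, ‖(ratPlusSymbol f x : ℚ_[p])‖ ≤ 1)
    (htab : ∀ u : ℕ, u < p ^ (c.n + 1) → ¬ p ∣ u →
      ratPlusSymbol f ((u : ℚ) / (p : ℚ) ^ (c.n + 1)) = (c.tabHi.getD u 0 : ℚ) / D ∧
      ratPlusSymbol f ((u : ℚ) / (p : ℚ) ^ c.n) = (c.tabLo.getD u 0 : ℚ) / D) :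
    PowerSeries.coeff c.r (padicLFunction f (unitRoot W p : ℚ_[p])) ≠ 0 := by
  obtain ⟨hp2, hA, hAu, ⟨v, hv, hfac, hm, hHL⟩, hcard, hunit, hHi, hLo⟩ := of_decide_eq_true hc
  rw [← hap] at hA
  exact coeff_ne_zero_of_symbolTableLv p hp2 W hord hf v (c.r.factorial / p ^ v) hfac hm c.n
    (Nat.lt_succ_iff.mp (Finset.mem_range.mp hv)) c.tabHi c.tabLo D hD c.H c.L c.A hA hAu hHL hcard hunit
    hHi hLo hint htab

/-- **The `p`-adic row from a `SymbolCertL` passing `validLv`, at an odd prime** (as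
`padicRow_of_symbolCertL_odd`: `rank_ℤ E(ℚ) = r`, `ord_{T=0} L_p = r`, `Ш(E/ℚ)[p^∞]` finite, Schneider
non-degeneracy for every canonical height datum, `corank Sel_{p^∞} = r`, GIVEN `hPRS`, `hσ`, `hkato`, the
newform and the symbol DATA). [cite: BalakrishnanMullerStein2015, Thm. 1.7 and p. 3]
[cite: Kato2004Asterisque, Thm. 17.4 (p. 273)] [cite: MazurSteinTate2006, Thm. 1.3]
[cite: MazurTateTeitelbaum1986Invent, §I.10–I.13] -/
theorem padicRow_of_symbolCertLv_odd (hPRS : Schneider1985_order_charGenerator_odd)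
    (hσ : mazur_tate_sigma_exists_odd) (W : WeierstrassCurve ℚ) [W.IsElliptic] [W.IsGloballyMinimal]
    (hord : IsOrdinaryAt W p) {ap : ℤ} (hap : W.frobeniusTrace p = ap) {N : ℕ} [NeZero N]
    {f : CuspForm (Gamma0 N) 2} (hf : IsNewformOf W f)
    (hkato : ∀ (κ : ZpExtension ℚ p) (γ : Field.absoluteGaloisGroup ℚ),
      kato_divisibility W p (κ := κ) (γ := γ) (f := f))
    (c : SymbolCertL) (hc : c.validLv p ap = true) (hlow : c.r ≤ W.mordellWeilRank) (D : ℚ)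
    (hD : ‖(D : ℚ_[p])‖ = 1) (hint : ∀ x : ℚ, ‖(ratPlusSymbol f x : ℚ_[p])‖ ≤ 1)
    (htab : ∀ u : ℕ, u < p ^ (c.n + 1) → ¬ p ∣ u →
      ratPlusSymbol f ((u : ℚ) / (p : ℚ) ^ (c.n + 1)) = (c.tabHi.getD u 0 : ℚ) / D ∧
      ratPlusSymbol f ((u : ℚ) / (p : ℚ) ^ c.n) = (c.tabLo.getD u 0 : ℚ) / D) :
    W.mordellWeilRank = c.r ∧ (padicLFunction f (unitRoot W p : ℚ_[p])).order = c.r ∧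
      Finite (AddCommGroup.primaryComponent W.sha p) ∧
      (∀ Dh : PAdicHeightData W p, Dh.IsCanonical → SchneiderConjecture Dh) ∧
      W.selmerCorank p = c.r := by
  have hp2 : p ≠ 2 := (of_decide_eq_true hc).1
  have hLp := coeff_ne_zero_of_symbolCertLv p W hord hf hap c hc D hD hint htab
  obtain ⟨hr, ho, hfin, hS⟩ := padicRow_of_certificate_odd hPRS hσ W p hkato hp2 hord hf hlow hLp
  exact ⟨hr, ho, hfin, hS, selmerCorank_eq_of_certificate_odd hPRS hσ W p hkato hp2 hord hf hlow hLp⟩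

end HigherLevel

/-! ### One rank-3 cell at an odd prime -/

namespace AtlasCell

variable (c : AtlasCell)

/-- **The kernel test of a RANK-3 cell at an ODD prime** against the curve's integer model `e`: `p ≠ 2`,
`p ∤ Δ(e)`, `#Ẽ(𝔽_p) = p + 1 − a_p`, `p ∤ a_p`, and `validLv p a_p` of the `r = 3` certificate `certL3`
(exactly `AtlasCell.check3` with `5 ≤ p` replaced by `p ≠ 2` and `validL` by `validLv`; at `p = 3` the
search finds `v = 1` and tests `3^{n-1} ∤ A·H − L`). [folklore] -/
def checkOdd3 (e : WeierstrassCurve ℤ) : Bool :=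
  decide (c.p ≠ 2) && decide (¬ ((c.p : ℤ) ∣ e.Δ)) && decide ((c.count e : ℤ) = c.p + 1 - c.ap) &&
    decide (¬ ((c.p : ℤ) ∣ c.ap)) &&
    if hp : primeB c.p = true then @SymbolCertL.validLv c.p ⟨prime_of_primeB hp⟩ c.ap c.certL3 else false

/-- A cell passing the `p ≥ 5` rank-3 test `check3` passes `checkOdd3`. [folklore] -/
theorem checkOdd3_of_check3 {e : WeierstrassCurve ℤ} (h : c.check3 e = true) : c.checkOdd3 e = true := by
  have h5 := (arith_of_check3 h).2.1
  simp only [check3, Bool.and_eq_true, decide_eq_true_eq] at h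
  simp only [checkOdd3, Bool.and_eq_true, decide_eq_true_eq]
  refine ⟨⟨⟨⟨by omega, h.1.1.1.2⟩, h.1.1.2⟩, h.1.2⟩, ?_⟩
  by_cases hp : primeB c.p = true
  · have h2 := h.2
    rw [dif_pos hp] at h2 ⊢
    exact @SymbolCertL.validLv_of_validL c.p ⟨prime_of_primeB hp⟩ _ _ h2
  · rw [dif_neg hp] at h; exact absurd h.2 Bool.false_ne_true

section Soundness

variable {c} {e : WeierstrassCurve ℤ}

/-- **The decidable content of a cell passing `checkOdd3`** (one lemma): `p` prime, `p ≠ 2`, `p ∤ Δ(e)`,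
`#Ẽ(𝔽_p) = p + 1 − a_p` (kernel count), `p ∤ a_p`. [folklore] -/
theorem sound_of_checkOdd3 (h : c.checkOdd3 e = true) :
    c.p.Prime ∧ c.p ≠ 2 ∧ ¬ ((c.p : ℤ) ∣ e.Δ) ∧ (c.count e : ℤ) = c.p + 1 - c.ap ∧
      ¬ ((c.p : ℤ) ∣ c.ap) := by
  simp only [checkOdd3, Bool.and_eq_true, decide_eq_true_eq] at h
  obtain ⟨⟨⟨⟨h2, hΔ⟩, hcount⟩, hap⟩, hv⟩ := h
  refine ⟨?_, h2, hΔ, hcount, hap⟩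
  by_cases hp : primeB c.p = true
  · exact prime_of_primeB hp
  · rw [dif_neg hp] at hv; exact absurd hv Bool.false_ne_true

/-- **The row inputs of a cell passing `checkOdd3`** (one lemma): the cell's `a_p` IS the Frobenius trace
of `e ⊗ ℚ` (kernel point count `= #Ẽ(𝔽_p)`, `p ≠ 2`), `p` is good ORDINARY for `e ⊗ ℚ`, and the `r = 3`
certificate passes `validLv`. [cite: SilvermanAEC2009, VII.1 Remark 1.1] -/
theorem rowInputs_of_checkOdd3 (h : c.checkOdd3 e = true) [Fact c.p.Prime]
    [(e.baseChange ℚ).IsGloballyMinimal] :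
    (e.baseChange ℚ).frobeniusTrace c.p = c.ap ∧ IsOrdinaryAt (e.baseChange ℚ) c.p ∧
      c.certL3.validLv c.p c.ap = true := by
  obtain ⟨-, h2, hΔ, hcount, hap⟩ := sound_of_checkOdd3 h
  have hv : c.certL3.validLv c.p c.ap = true := by
    simp only [checkOdd3, Bool.and_eq_true] at h
    by_cases hp : primeB c.p = true
    · have h' := h.2
      rw [dif_pos hp] at h'
      exact h'
    · rw [dif_neg hp] at h; exact absurd h.2 Bool.false_ne_true
  have hΔ' : (e.map (Int.castRingHom (ZMod c.p))).Δ ≠ 0 := by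
    rw [WeierstrassCurve.map_Δ, eq_intCast, ne_eq, ZMod.intCast_zmod_eq_zero_iff_dvd]
    exact hΔ
  have hcard : Nat.card ((e.map (Int.castRingHom (ZMod c.p))).toAffine.Point) = c.count e := by
    rw [natCard_point_eq_one_add_eulerAffineCount c.p h2 _ hΔ']
    rfl
  have htr : (e.baseChange ℚ).frobeniusTrace c.p = c.ap := by
    rw [frobeniusTrace_baseChange_int _ hcard]
    omega
  refine ⟨htr, ?_, hv⟩
  refine isOrdinaryAt_baseChange_int_of_card c.p e hΔ hcard ?_
  rw [← frobeniusTrace_baseChange_int _ hcard, htr]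
  exact hap

end Soundness

end AtlasCell

/-! ### One rank-3 curve at an odd prime -/

namespace AtlasCurve3

variable (C : AtlasCurve3)

/-- **The kernel test of a rank-3 curve at an odd prime**: `Δ ≠ 0` and every cell passes `checkOdd3`
against the integer model. [folklore] -/
def checkOdd : Bool :=
  decide (C.e.Δ ≠ 0) && C.cells.all fun c => c.checkOdd3 C.e

/-- The third global-minimality criterion (the rank-2 kit's `minCheck₃` on the shared model `toA`).
[cite: Kraus1989, Prop. 2] [cite: SilvermanAEC2009, VII.1 Remark 1.1] -/
def minCheck₃ : Bool := C.toA.minCheck₃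

variable {C}

/-- An `AtlasCurve3` passing the rank-3 odd-prime test `AtlasCurve3.checkOdd` (cells tested by `checkOdd3`,
L-certificate rule `validLv`) is elliptic — the `AtlasCurve3` analogue of `AtlasCurve.isElliptic_odd`, for a different
test, hence a separate theorem. [folklore] -/
theorem isElliptic_of_checkOdd {C : AtlasCurve3} (h : C.checkOdd = true) : (C.e.baseChange ℚ).IsElliptic := by
  simp only [checkOdd, Bool.and_eq_true, decide_eq_true_eq] at h
  exact isElliptic_baseChange_int _ h.1

/- Minimality instances for the parts come straight from the landed `AtlasCurve` theorems through `toA`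
(`AtlasCurve.isGloballyMinimal (C := C.toA) hm`, `…isGloballyMinimal₂…`, `…isGloballyMinimal₃…`: `C.toA.e = C.e` and
`C.minCheck₃ = C.toA.minCheck₃` hold by `rfl`), so no wrapper is declared here. -/

/-- Every cell of an odd-checking rank-3 curve passes `checkOdd3`. [folklore] -/
theorem cell_checkOdd (h : C.checkOdd = true) {c : AtlasCell} (hc : c ∈ C.cells) :
    c.checkOdd3 C.e = true := by
  simp only [checkOdd, Bool.and_eq_true, List.all_eq_true] at h
  exact h.2 c hc

/-- The prime of a cell of an `AtlasCurve3` passing `AtlasCurve3.checkOdd` is prime (analogue of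
`AtlasCurve.prime_of_mem_odd` for the rank-3 test). [folklore] -/
theorem prime_of_checkOdd {C : AtlasCurve3} (h : C.checkOdd = true) {c : AtlasCell} (hc : c ∈ C.cells) :
    c.p.Prime :=
  (AtlasCell.sound_of_checkOdd3 (cell_checkOdd h hc)).1

/-- **The `p`-adic row of a rank-3 atlas cell at an odd prime.** For an odd-checking curve `C` and a cell
`c ∈ C.cells` (in the parts `p = 3`): GIVEN `hPRS` (Perrin-Riou–Schneider at `p > 2`, BMS Thm. 1.7), `hσ`
(Mazur–Tate sigma pair at odd `p`, MST 2006 Thm. 1.3), `hkato` (Kato Thm. 17.4 for all cyclotomic data), the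
newform `hf`, the census rank certificate `hlow : 3 ≤ rank row.curve`, and the symbol DATA `hint`/`htab`:
`rank = 3`, `ord_{T=0} L_p = 3`, `Ш[p^∞]` finite, Schneider non-degeneracy at `p` for every canonical height
datum, `corank Sel_{p^∞} = 3`. [cite: BalakrishnanMullerStein2015, Thm. 1.7 and p. 3]
[cite: Kato2004Asterisque, Thm. 17.4 (p. 273)] [cite: MazurTateTeitelbaum1986Invent, §I.10–I.13]
[cite: MazurSteinTate2006, Thm. 1.3] -/
theorem padicRowOdd (h : C.checkOdd = true) {c : AtlasCell} (hc : c ∈ C.cells) [Fact c.p.Prime]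
    [(C.e.baseChange ℚ).IsElliptic] [(C.e.baseChange ℚ).IsGloballyMinimal]
    (hPRS : Schneider1985_order_charGenerator_odd) (hσ : mazur_tate_sigma_exists_odd)
    {N : ℕ} [NeZero N] {f : CuspForm (Gamma0 N) 2} (hf : IsNewformOf (C.e.baseChange ℚ) f)
    (hkato : ∀ (κ : ZpExtension ℚ c.p) (γ : Field.absoluteGaloisGroup ℚ),
      kato_divisibility (C.e.baseChange ℚ) c.p (κ := κ) (γ := γ) (f := f))
    (hlow : 3 ≤ C.row.curve.mordellWeilRank) (D : ℚ) (hD : ‖(D : ℚ_[c.p])‖ = 1)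
    (hint : ∀ x : ℚ, ‖(ratPlusSymbol f x : ℚ_[c.p])‖ ≤ 1)
    (htab : ∀ u : ℕ, u < c.p ^ (c.n + 1) → ¬ c.p ∣ u →
      ratPlusSymbol f ((u : ℚ) / (c.p : ℚ) ^ (c.n + 1)) = (c.tabHi.getD u 0 : ℚ) / D ∧
      ratPlusSymbol f ((u : ℚ) / (c.p : ℚ) ^ c.n) = (c.tabLo.getD (u % c.p ^ c.n) 0 : ℚ) / D) :
    C.row.curve.mordellWeilRank = 3 ∧
      (padicLFunction f (unitRoot (C.e.baseChange ℚ) c.p : ℚ_[c.p])).order = 3 ∧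
      Finite (AddCommGroup.primaryComponent (C.e.baseChange ℚ).sha c.p) ∧
      (∀ Dh : PAdicHeightData (C.e.baseChange ℚ) c.p, Dh.IsCanonical → SchneiderConjecture Dh) ∧
      (C.e.baseChange ℚ).selmerCorank c.p = 3 := by
  have hk : c.checkOdd3 C.e = true := cell_checkOdd h hc
  have hbc : C.e.baseChange ℚ = C.row.curve := by
    ext <;> simp [e, Rank3Row.curve, WeierstrassCurve.baseChange]
  have hlow' : c.certL3.r ≤ (C.e.baseChange ℚ).mordellWeilRank := by
    rw [hbc]; exact hlow
  have htab' : ∀ u : ℕ, u < c.p ^ (c.certL3.n + 1) → ¬ c.p ∣ u →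
      ratPlusSymbol f ((u : ℚ) / (c.p : ℚ) ^ (c.certL3.n + 1)) = (c.certL3.tabHi.getD u 0 : ℚ) / D ∧
      ratPlusSymbol f ((u : ℚ) / (c.p : ℚ) ^ c.certL3.n) = (c.certL3.tabLo.getD u 0 : ℚ) / D :=
    fun u hu hpu => by
      rw [AtlasCell.certL3_tabLo_getD c hu]
      exact htab u hu hpu
  obtain ⟨hap, hord, hv⟩ := AtlasCell.rowInputs_of_checkOdd3 (e := C.e) hk
  obtain ⟨hr, ho, hfin, hS, hsel⟩ := padicRow_of_symbolCertLv_odd c.p hPRS hσ (C.e.baseChange ℚ)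
    hord hap hf hkato c.certL3 hv hlow' D hD hint htab'
  exact ⟨by rw [← hbc]; exact hr, ho, hfin, hS, hsel⟩

/-- From a table theorem `atlas.all (checkOdd ∧ minCheck) = true` to the two tests of a member.
[folklore] -/
theorem check_of_allOdd {atlas : List AtlasCurve3}
    (h : atlas.all (fun C => C.checkOdd && C.minCheck) = true) {C : AtlasCurve3} (hC : C ∈ atlas) :
    C.checkOdd = true ∧ C.minCheck = true := by
  simp only [List.all_eq_true, Bool.and_eq_true] at h
  exact h C hC

/-- From a table theorem `atlas.all (checkOdd ∧ minCheck₂) = true` to the two tests of a member.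
[folklore] -/
theorem check_of_allOdd₂ {atlas : List AtlasCurve3}
    (h : atlas.all (fun C => C.checkOdd && C.minCheck₂) = true) {C : AtlasCurve3} (hC : C ∈ atlas) :
    C.checkOdd = true ∧ C.minCheck₂ = true := by
  simp only [List.all_eq_true, Bool.and_eq_true] at h
  exact h C hC

/-- From a table theorem `atlas.all (checkOdd ∧ minCheck₃) = true` to the two tests of a member.
[folklore] -/
theorem check_of_allOdd₃ {atlas : List AtlasCurve3}
    (h : atlas.all (fun C => C.checkOdd && C.minCheck₃) = true) {C : AtlasCurve3} (hC : C ∈ atlas) :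
    C.checkOdd = true ∧ C.minCheck₃ = true := by
  simp only [List.all_eq_true, Bool.and_eq_true] at h
  exact h C hC

end AtlasCurve3

end Summit.BirchSwinnertonDyer.BirchSwinnertonDyer.Rank2Observatory

end
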